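import Mathlib
import Literature.NumberTheory.DiophantineGeometry.TernaryConicPointBound
import Literature.NumberTheory.DiophantineGeometry.TernaryConicPointBoundPlane
import Literature.NumberTheory.DiophantineGeometry.TernaryConicPointBoundLocal
import Literature.NumberTheory.DiophantineGeometry.TernaryConicPointBoundAuxPrime
import Literature.NumberTheory.Sieve.DivisorBound

/-!
# Proof of Heath-Brown's bound for primitive zeros of a ternary quadratic form in a box

This file discharges the named fact
`Literature.NumberTheory.DiophantineGeometry.TernaryConicPointBound` ([Heathbrown2002, Cor. 2] in
`δ`-absorbed form): `theorem TernaryConicPointBound_holds : TernaryConicPointBound`.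

Source and architecture.  [Heathbrown2002, Cor. 2] is obtained (loc. cit., before Cor. 2) by
substituting the bound (1.8) of [Heathbrown2002, Thm 3] for [Heathbrown1997, Lemma 2] in the proof of
[Heathbrown1997, Thm 2] (Acta Arith. 79, §2).  That proof: (i) for each `p^e ∥ Δ` the zeros of `q`
lie on few lattices of determinant `≥ p^{e-2f}` (`p^f ∥ Δ₀`), combined by the Chinese remainder
theorem; (ii) on each lattice, count by (1.8).  Our formalisation keeps this architecture with
elementary substitutes, all proved in the sibling files:

1. *local/global classes* (`TernaryConicPointBoundBinary`, `…Local`, `global_labels` below): the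
   zeros carry `≤ τ(Δ)³` labels such that equally-labelled zeros `x, y` have `D ∣ xᵀ M y` with
   `Δ³ ∣ 8 D³ Δ₀⁴` (this is (i) with Heath-Brown's remark that the exponent of `Δ₀` "is easy to
   improve");
2. *the determinant method for conics* (`…AuxPrime`, the case `d = 2` of [Heathbrown2002, Thm 3]
   in first-order form): for a prime `p ∤ 2Δ`, three zeros in the same class modulo `p` have
   `p³ ∣ det X`, and there are `≤ 9p` classes;
3. *Gram gap and plane sections* (`…Plane`): `det(X)² Δ = 2 B₀₁B₀₂B₁₂`, so in a combined class a
   non-zero `det X` has `2Δ₀²|det X| ≥ p³Δ`, impossible in the box once `p³Δ > 12 V Δ₀²`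
   (`|det X| ≤ 6V`, `V = B₀B₁B₂`); a coplanar class has `≤ 4` primitive points;
4. *the auxiliary prime* (`exists_prime_not_dvd_le_rpow` below, Bertrand's postulate in dyadic
   blocks): `p ∤ 2Δ` with `P₀ ≤ p ≪_δ P₀ Δ^{δ/2}`, `P₀ ≈ (12VΔ₀²/Δ)^{1/3}`;
5. *assembly* (`card_le_of_prime`, `TernaryConicPointBound_holds`): the count is
   `≤ 4 · τ(Δ)³ · 9p ≪_δ Δ^{δ/2} · (1 + (VΔ₀²/Δ)^{1/3}) Δ^{δ/2}`, using the divisor bound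
   `Literature.NumberTheory.Sieve.exists_card_divisors_le_mul_rpow`.

No definitions are introduced; `primitiveConicZeros`, `minorGcd` are those of the fact file.

## References

* D. R. Heath-Brown, *The density of rational points on curves and surfaces*, Ann. of Math. 155
  (2002) 553–595, Corollary 2 (and Theorem 3, §3) [Heathbrown2002].
* D. R. Heath-Brown, *The density of rational points on cubic surfaces*, Acta Arith. 79 (1997)
  17–30, Theorem 2 and §2 [Heathbrown1997].
* G. H. Hardy, E. M. Wright, *An Introduction to the Theory of Numbers*, Thm 315 (divisor bound)
  [HardyWright2008].
-/

namespace Literature.NumberTheory.DiophantineGeometry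

namespace TernaryConic

open Finset Matrix

/-! ### Choosing the auxiliary prime -/

/-- Bertrand's postulate in dyadic blocks: if `0 < m < A^{K+1}` (`A ≥ 1`), some prime `p ∤ m`
satisfies `A < p ≤ 2^{K+1} A` (the `K + 1` Bertrand primes in `(2^i A, 2^{i+1} A]` cannot all divide
`m`, their product exceeding `A^{K+1}`). [folklore] -/
theorem exists_prime_not_dvd (A K m : ℕ) (hA : 1 ≤ A) (hm : 0 < m) (hmA : m < A ^ (K + 1)) :
    ∃ p : ℕ, p.Prime ∧ A < p ∧ p ≤ 2 ^ (K + 1) * A ∧ ¬ p ∣ m := by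
  have hq : ∀ i : ℕ, ∃ q : ℕ, q.Prime ∧ 2 ^ i * A < q ∧ q ≤ 2 * (2 ^ i * A) := fun i =>
    Nat.exists_prime_lt_and_le_two_mul _ (by positivity)
  choose q hqp hql hqu using hq
  have hAq : ∀ i, A < q i := fun i =>
    lt_of_le_of_lt (le_mul_of_one_le_left (Nat.zero_le _) Nat.one_le_two_pow) (hql i)
  by_contra hno
  push Not at hno
  have hqm : ∀ i ∈ Finset.range (K + 1), q i ∣ m := by
    intro i hi
    rw [Finset.mem_range] at hi
    refine hno (q i) (hqp i) (hAq i) ?_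
    calc q i ≤ 2 * (2 ^ i * A) := hqu i
      _ = 2 ^ (i + 1) * A := by ring
      _ ≤ 2 ^ (K + 1) * A := by gcongr <;> omega
  have hqlt : ∀ i j, i < j → q i < q j := by
    intro i j hij
    calc q i ≤ 2 * (2 ^ i * A) := hqu i
      _ = 2 ^ (i + 1) * A := by ring
      _ ≤ 2 ^ j * A := by gcongr <;> omega
      _ < q j := hql j
  have hinj : Set.InjOn q ↑(Finset.range (K + 1)) := by
    intro i _ j _ h
    rcases lt_trichotomy i j with hij | hij | hij
    · exact absurd h (hqlt i j hij).ne
    · exact hij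
    · exact absurd h (hqlt j i hij).ne'
  have hprod_dvd : ∏ i ∈ Finset.range (K + 1), q i ∣ m := by
    have himage : ∏ i ∈ Finset.range (K + 1), q i = ∏ x ∈ (Finset.range (K + 1)).image q, x := by
      rw [Finset.prod_image hinj]
    rw [himage]
    refine Finset.prod_primes_dvd m ?_ ?_
    · intro a ha
      obtain ⟨i, -, rfl⟩ := Finset.mem_image.mp ha
      exact (hqp i).prime
    · intro a ha
      obtain ⟨i, hi, rfl⟩ := Finset.mem_image.mp ha
      exact hqm i hi
  have hle : ∏ i ∈ Finset.range (K + 1), q i ≤ m := Nat.le_of_dvd hm hprod_dvd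
  have hge : A ^ (K + 1) ≤ ∏ i ∈ Finset.range (K + 1), q i := by
    calc A ^ (K + 1) = ∏ _i ∈ Finset.range (K + 1), A := by
          rw [Finset.prod_const, Finset.card_range]
      _ ≤ ∏ i ∈ Finset.range (K + 1), q i :=
          Finset.prod_le_prod (fun i _ => Nat.zero_le _) fun i _ => (hAq i).le
  omega

/-- The auxiliary prime: for `δ > 0` there is `C` such that for all `P₀, m ≥ 1` some prime `p ∤ m`
satisfies `P₀ ≤ p ≤ C P₀ m^δ` (take `A = max(P₀, 2^{1/δ})`, `K = log_A m` in
`exists_prime_not_dvd`). [folklore] -/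
theorem exists_prime_not_dvd_le_rpow {δ : ℝ} (hδ : 0 < δ) :
    ∃ C : ℝ, 0 < C ∧ ∀ P₀ m : ℕ, 1 ≤ P₀ → 1 ≤ m →
      ∃ p : ℕ, p.Prime ∧ P₀ ≤ p ∧ ¬ p ∣ m ∧ (p : ℝ) ≤ C * P₀ * (m : ℝ) ^ δ := by
  obtain ⟨b, hb⟩ : ∃ b : ℕ, b = ⌈(2 : ℝ) ^ (1 / δ)⌉₊ + 2 := ⟨_, rfl⟩
  refine ⟨2 * ((b : ℝ) + 1), by positivity, fun P₀ m hP₀ hm => ?_⟩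
  obtain ⟨A, hA⟩ : ∃ A : ℕ, A = max P₀ b := ⟨_, rfl⟩
  have hbA : b ≤ A := by rw [hA]; exact le_max_right _ _
  have hPA : P₀ ≤ A := by rw [hA]; exact le_max_left _ _
  have hA1 : 1 < A := by omega
  obtain ⟨K, hK⟩ : ∃ K : ℕ, K = Nat.log A m := ⟨_, rfl⟩
  have hmA : m < A ^ (K + 1) := by rw [hK]; exact Nat.lt_pow_succ_log_self hA1 m
  have hAK : A ^ K ≤ m := by rw [hK]; exact Nat.pow_log_le_self A (by omega)
  obtain ⟨p, hp, hAp, hple, hpm⟩ := exists_prime_not_dvd A K m (by omega) (by omega) hmA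
  refine ⟨p, hp, hPA.trans hAp.le, hpm, ?_⟩
  have hA0 : (0 : ℝ) ≤ A := Nat.cast_nonneg _
  have hAδ : (2 : ℝ) ≤ (A : ℝ) ^ δ := by
    have h1 : (2 : ℝ) ^ (1 / δ) ≤ b := by
      calc (2 : ℝ) ^ (1 / δ) ≤ ⌈(2 : ℝ) ^ (1 / δ)⌉₊ := Nat.le_ceil _
        _ ≤ b := by rw [hb]; push_cast; linarith
    have h2 : (b : ℝ) ≤ A := by exact_mod_cast hbA
    calc (2 : ℝ) = ((2 : ℝ) ^ (1 / δ)) ^ δ := by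
          rw [← Real.rpow_mul (by norm_num), one_div_mul_cancel hδ.ne', Real.rpow_one]
      _ ≤ (A : ℝ) ^ δ := Real.rpow_le_rpow (by positivity) (h1.trans h2) hδ.le
  have h2K : (2 : ℝ) ^ K ≤ (m : ℝ) ^ δ := by
    calc (2 : ℝ) ^ K ≤ ((A : ℝ) ^ δ) ^ K := pow_le_pow_left₀ (by norm_num) hAδ K
      _ = ((A : ℝ) ^ K) ^ δ := by
          rw [← Real.rpow_natCast, ← Real.rpow_mul hA0, mul_comm, Real.rpow_mul hA0,
            Real.rpow_natCast]
      _ ≤ (m : ℝ) ^ δ := Real.rpow_le_rpow (by positivity) (by exact_mod_cast hAK) hδ.le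
  have hAle : (A : ℝ) ≤ ((b : ℝ) + 1) * P₀ := by
    have h1 : (A : ℝ) ≤ P₀ + b := by
      have : A ≤ P₀ + b := by rw [hA]; exact max_le (Nat.le_add_right _ _) (Nat.le_add_left _ _)
      exact_mod_cast this
    have hP : (1 : ℝ) ≤ P₀ := by exact_mod_cast hP₀
    nlinarith
  calc (p : ℝ) ≤ ((2 ^ (K + 1) * A : ℕ) : ℝ) := by exact_mod_cast hple
    _ = 2 * 2 ^ K * A := by push_cast; ring
    _ ≤ 2 * (m : ℝ) ^ δ * (((b : ℝ) + 1) * P₀) := by gcongr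
    _ = 2 * ((b : ℝ) + 1) * P₀ * (m : ℝ) ^ δ := by ring

/-! ### Global classes: combining the local labels over the primes dividing `Δ` -/

/-- For `e ≥ 1`: `3e + 3 ≤ (e + 1)³`. [folklore] -/
theorem three_mul_add_three_le_cube {e : ℕ} (he : 1 ≤ e) : 3 * e + 3 ≤ (e + 1) ^ 3 := by
  have : (e + 1) ^ 3 = (e + 1) * ((e + 1) * (e + 1)) := by ring
  rw [this]
  nlinarith

/-- `Δ₀(M) ≠ 0` when `det M ≠ 0`. [folklore] -/
theorem minorGcd_ne_zero (M : Matrix (Fin 3) (Fin 3) ℤ) (hdet : M.det ≠ 0) : minorGcd M ≠ 0 := by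
  intro h0
  have hA := adjugate_eq_zero_of_minorGcd_eq_zero M h0
  have h1 := congrFun (congrFun (Matrix.mul_adjugate M) 0) 0
  rw [hA, Matrix.mul_zero] at h1
  simp at h1
  exact hdet h1.symm

/-- **Global classes.** For a symmetric integral `3 × 3` matrix `M` with `det M ≠ 0` there are an
integer `D ≥ 1` all of whose prime factors divide `Δ = |det M|`, with `Δ³ ∣ 8 D³ Δ₀⁴`, and a
labelling of the zeros of `xᵀ M x` by at most `τ(Δ)³` labels such that two zeros with the same label
have `D ∣ xᵀ M y`.  (Product over `ℓ ∣ Δ` of `local_labels`; this is the substitute for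
"`x` lies in one of `≤ 2 d₃(Δ)` lattices of determinant `≥ Δ/(2⁸Δ₀²)`" in [Heathbrown1997, §2].)
[folklore] -/
theorem global_labels (M : Matrix (Fin 3) (Fin 3) ℤ) (hM : M.IsSymm) (hdet : M.det ≠ 0) :
    ∃ (D : ℕ) (glab : (Fin 3 → ℤ) → (ℕ → ℕ)) (G : Finset (ℕ → ℕ)), 0 < D ∧
      (∀ q : ℕ, q.Prime → q ∣ D → q ∣ M.det.natAbs) ∧
      #G ≤ #M.det.natAbs.divisors ^ 3 ∧
      M.det.natAbs ^ 3 ∣ 8 * D ^ 3 * (minorGcd M).natAbs ^ 4 ∧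
      (∀ x : Fin 3 → ℤ, x ⬝ᵥ M *ᵥ x = 0 → glab x ∈ G) ∧
      (∀ x y : Fin 3 → ℤ, x ⬝ᵥ M *ᵥ x = 0 → y ⬝ᵥ M *ᵥ y = 0 → glab x = glab y →
        (D : ℤ) ∣ x ⬝ᵥ M *ᵥ y) := by
  classical
  obtain ⟨Δ, hΔ⟩ : ∃ Δ : ℕ, Δ = M.det.natAbs := ⟨_, rfl⟩
  have hΔ0 : Δ ≠ 0 := by rw [hΔ]; exact Int.natAbs_ne_zero.mpr hdet
  obtain ⟨S, hS⟩ : ∃ S : Finset ℕ, S = Δ.primeFactors := ⟨_, rfl⟩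
  have hSprime : ∀ ℓ : S, (ℓ : ℕ).Prime := fun ℓ =>
    Nat.prime_of_mem_primeFactors (by rw [← hS]; exact ℓ.2)
  have hloc : ∀ ℓ : S, ∃ (m : ℕ) (lab : (Fin 3 → ℤ) → ℕ) (L : Finset ℕ),
      #L ≤ 3 * padicValNat ℓ M.det.natAbs + 3 ∧
      3 * padicValNat ℓ M.det.natAbs ≤
        3 * m + 4 * padicValNat ℓ (minorGcd M).natAbs + (if (ℓ : ℕ) = 2 then 3 else 0) ∧
      (∀ x : Fin 3 → ℤ, x ⬝ᵥ M *ᵥ x = 0 → lab x ∈ L) ∧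
      (∀ x y : Fin 3 → ℤ, x ⬝ᵥ M *ᵥ x = 0 → y ⬝ᵥ M *ᵥ y = 0 → lab x = lab y →
        ((ℓ : ℕ) : ℤ) ^ m ∣ x ⬝ᵥ M *ᵥ y) := fun ℓ => local_labels (hSprime ℓ) M hM hdet
  choose m lab L hL hineq hmem hpol using hloc
  let ext : (S → ℕ) → (ℕ → ℕ) := fun g n => if h : n ∈ S then g ⟨n, h⟩ else 0
  refine ⟨∏ ℓ : S, (ℓ : ℕ) ^ m ℓ, fun x => ext fun ℓ => lab ℓ x,
    (Fintype.piFinset fun ℓ : S => L ℓ).image ext, ?_, ?_, ?_, ?_, ?_, ?_⟩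
  · exact Finset.prod_pos fun ℓ _ => pow_pos (hSprime ℓ).pos _
  · -- prime factors of `D`
    intro q hq hqD
    obtain ⟨ℓ, -, hℓ⟩ := (hq.prime.dvd_finsetProd_iff _).mp hqD
    have h1 : q ∣ (ℓ : ℕ) := hq.dvd_of_dvd_pow hℓ
    have h2 : q = ℓ := (Nat.prime_dvd_prime_iff_eq hq (hSprime ℓ)).mp h1
    have h3 : (ℓ : ℕ) ∈ Δ.primeFactors := by rw [← hS]; exact ℓ.2
    rw [h2, ← hΔ]
    exact Nat.dvd_of_mem_primeFactors h3
  · -- number of labels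
    refine Finset.card_image_le.trans ?_
    rw [Fintype.card_piFinset, ← hΔ, Nat.card_divisors hΔ0, ← Finset.prod_pow, ← hS,
      ← Finset.prod_coe_sort S]
    refine Finset.prod_le_prod (fun ℓ _ => Nat.zero_le _) fun ℓ _ => ?_
    have he : Δ.factorization ℓ = padicValNat ℓ Δ := Nat.factorization_def Δ (hSprime ℓ)
    have he1 : 1 ≤ Δ.factorization ℓ := by
      have h3 : (ℓ : ℕ) ∈ Δ.primeFactors := by rw [← hS]; exact ℓ.2
      exact Nat.pos_of_ne_zero (Finsupp.mem_support_iff.mp (by rwa [Nat.support_factorization]))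
    calc #(L ℓ) ≤ 3 * padicValNat ℓ M.det.natAbs + 3 := hL ℓ
      _ = 3 * Δ.factorization ℓ + 3 := by rw [he, hΔ]
      _ ≤ (Δ.factorization ℓ + 1) ^ 3 := three_mul_add_three_le_cube he1
  · -- `Δ³ ∣ 8 D³ Δ₀⁴`
    rw [← hΔ]
    refine (Nat.dvd_iff_prime_pow_dvd_dvd _ _).mpr fun q k hq hqk => ?_
    haveI : Fact q.Prime := ⟨hq⟩
    have hk : k ≤ 3 * padicValNat q Δ := by
      have := (padicValNat_dvd_iff_le (pow_ne_zero 3 hΔ0)).mp hqk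
      rwa [padicValNat.pow] at this
    by_cases hqS : q ∈ S
    · have hi := hineq ⟨q, hqS⟩
      rw [← hΔ] at hi
      dsimp only at hi
      obtain ⟨t, ht⟩ : ∃ t : ℕ, (if q = 2 then 3 else 0) = t := ⟨_, rfl⟩
      rw [ht] at hi
      have h8 : q ^ t ∣ 8 := by
        by_cases hq2 : q = 2
        · rw [if_pos hq2] at ht
          rw [← ht, hq2]; norm_num
        · rw [if_neg hq2] at ht
          rw [← ht, pow_zero]; exact one_dvd _
      have hD : q ^ m ⟨q, hqS⟩ ∣ ∏ ℓ : S, (ℓ : ℕ) ^ m ℓ :=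
        Finset.dvd_prod_of_mem (fun ℓ : S => (ℓ : ℕ) ^ m ℓ) (Finset.mem_univ (⟨q, hqS⟩ : S))
      have hΔ0' : q ^ padicValNat q (minorGcd M).natAbs ∣ (minorGcd M).natAbs := pow_padicValNat_dvd
      have hall : q ^ (t + 3 * m ⟨q, hqS⟩ + 4 * padicValNat q (minorGcd M).natAbs) ∣
          8 * (∏ ℓ : S, (ℓ : ℕ) ^ m ℓ) ^ 3 * (minorGcd M).natAbs ^ 4 := by
        rw [pow_add, pow_add, pow_mul', pow_mul']
        exact mul_dvd_mul (mul_dvd_mul h8 (pow_dvd_pow_of_dvd hD 3)) (pow_dvd_pow_of_dvd hΔ0' 4)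
      exact (pow_dvd_pow q (by omega)).trans hall
    · have h0 : padicValNat q Δ = 0 := by
        refine padicValNat.eq_zero_of_not_dvd fun hqΔ => hqS ?_
        rw [hS]; exact Nat.mem_primeFactors.mpr ⟨hq, hqΔ, hΔ0⟩
      rw [h0, mul_zero, Nat.le_zero] at hk
      rw [hk, pow_zero]; exact one_dvd _
  · -- membership
    intro x hx
    exact Finset.mem_image.mpr ⟨fun ℓ => lab ℓ x, Fintype.mem_piFinset.mpr fun ℓ => hmem ℓ x hx, rfl⟩
  · -- equal labels
    intro x y hx hy hxy
    have hloc' : ∀ ℓ : S, ((ℓ : ℕ) : ℤ) ^ m ℓ ∣ x ⬝ᵥ M *ᵥ y := by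
      intro ℓ
      refine hpol ℓ x y hx hy ?_
      have := congrFun hxy ℓ
      simpa [ext] using this
    have hcop : Pairwise (Function.onFun IsCoprime fun ℓ : S => ((ℓ : ℕ) : ℤ) ^ m ℓ) := by
      intro ℓ ℓ' hne
      have hne' : (ℓ : ℕ) ≠ ℓ' := fun h => hne (Subtype.ext h)
      exact (Nat.isCoprime_iff_coprime.mpr ((Nat.coprime_primes (hSprime ℓ) (hSprime ℓ')).mpr hne')).pow
    have := Fintype.prod_dvd_of_coprime hcop hloc'
    push_cast
    exact this

/-! ### The count for a fixed auxiliary prime -/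

/-- Bézout form of primitivity. [folklore] -/
theorem exists_bezout_of_primitive (x : Fin 3 → ℤ) (hx : ∀ d : ℤ, (∀ i, d ∣ x i) → IsUnit d) :
    ∃ b : Fin 3 → ℤ, ∑ i, b i * x i = 1 := by
  set g₁ : ℕ := Int.gcd (x 0) (x 1) with hg₁
  set g : ℕ := Int.gcd (g₁ : ℤ) (x 2) with hg
  have hgdvd : ∀ i, (g : ℤ) ∣ x i := by
    intro i
    have h0 : (g : ℤ) ∣ (g₁ : ℤ) := Int.gcd_dvd_left ..
    fin_cases i
    · exact h0.trans (Int.gcd_dvd_left ..)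
    · exact h0.trans (Int.gcd_dvd_right ..)
    · exact Int.gcd_dvd_right ..
  have hg1 : (g : ℤ) = 1 := by
    have hu := hx g hgdvd
    rcases Int.isUnit_iff.mp hu with h | h
    · exact h
    · exfalso; have : (0 : ℤ) ≤ g := Nat.cast_nonneg _; linarith
  have e1 : (g₁ : ℤ) = x 0 * Int.gcdA (x 0) (x 1) + x 1 * Int.gcdB (x 0) (x 1) := Int.gcd_eq_gcd_ab _ _
  have e2 : (g : ℤ) = (g₁ : ℤ) * Int.gcdA (g₁ : ℤ) (x 2) + x 2 * Int.gcdB (g₁ : ℤ) (x 2) :=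
    Int.gcd_eq_gcd_ab _ _
  refine ⟨![Int.gcdA (x 0) (x 1) * Int.gcdA (g₁ : ℤ) (x 2),
    Int.gcdB (x 0) (x 1) * Int.gcdA (g₁ : ℤ) (x 2), Int.gcdB (g₁ : ℤ) (x 2)], ?_⟩
  simp only [Fin.sum_univ_three, Matrix.cons_val_zero, Matrix.cons_val_one, Matrix.cons_val_two,
    Matrix.head_cons, Matrix.tail_cons]
  linear_combination (-(Int.gcdA (g₁ : ℤ) (x 2))) * e1 - e2 + hg1

/-- **The count for a fixed auxiliary prime.** Let `M` be symmetric integral with `det M ≠ 0`,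
`Δ = |det M|`, `Δ₀ = minorGcd M`, `V = B₀B₁B₂`, and let `p` be an odd prime with `p ∤ det M` and
`p³ Δ > 12 V Δ₀²`. Then the primitive zeros of `xᵀ M x` in the box number at most
`4 · τ(Δ)³ · 9p`: classify by (global label, projective point modulo `p`); three zeros in a class have
`p³ ∣ det X` (`pow_three_dvd_det_of_cls`) and `D³`-large Gram determinant (`det_sq_mul_det_eq`),
forcing `det X = 0` as `|det X| ≤ 6V`; a class is then coplanar, with `≤ 4` points
(`card_le_four_of_coplanar`). [folklore] -/
theorem card_le_of_prime (M : Matrix (Fin 3) (Fin 3) ℤ) (hM : M.IsSymm) (hdet : M.det ≠ 0)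
    (B : Fin 3 → ℕ) {p : ℕ} (hp : p.Prime) (hp2 : p ≠ 2) (hpdet : ¬ (p : ℤ) ∣ M.det)
    (hbig : 12 * (B 0 * B 1 * B 2) * (minorGcd M).natAbs ^ 2 < p ^ 3 * M.det.natAbs) :
    (primitiveConicZeros M B).ncard ≤ 4 * (#M.det.natAbs.divisors ^ 3 * (3 * (3 * p))) := by
  classical
  haveI : Fact p.Prime := ⟨hp⟩
  have hpZ : Prime (p : ℤ) := Nat.prime_iff_prime_int.mp hp
  have hp2Z : ¬ (p : ℤ) ∣ 2 := by
    intro h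
    have h' : p ∣ 2 := by exact_mod_cast h
    exact hp2 ((Nat.prime_dvd_prime_iff_eq hp Nat.prime_two).mp h')
  obtain ⟨D, glab, G, hD, hDprime, hG, hDineq, hGmem, hGpol⟩ := global_labels M hM hdet
  -- the zero set as a finset
  set S := (Fintype.piFinset fun i => Finset.Icc (-(B i : ℤ)) (B i)).filter fun x =>
      (∀ d : ℤ, (∀ i, d ∣ x i) → IsUnit d) ∧ x ⬝ᵥ M *ᵥ x = 0 with hSdef
  have hSset : primitiveConicZeros M B = ↑S := by
    ext x
    simp only [primitiveConicZeros, Set.mem_setOf_eq, hSdef, Finset.coe_filter, Fintype.mem_piFinset,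
      Finset.mem_Icc, abs_le]
  rw [hSset, Set.ncard_coe_finset]
  have hS : ∀ x ∈ S, (∀ i, |x i| ≤ B i) ∧ (∀ d : ℤ, (∀ i, d ∣ x i) → IsUnit d) ∧ x ⬝ᵥ M *ᵥ x = 0 := by
    intro x hx
    simp only [hSdef, Finset.mem_filter, Fintype.mem_piFinset, Finset.mem_Icc] at hx
    exact ⟨fun i => abs_le.2 (hx.1 i), hx.2.1, hx.2.2⟩
  have hprim : ∀ x ∈ S, ∃ b : Fin 3 → ℤ, ∑ i, b i * x i = 1 := fun x hx =>
    exists_bezout_of_primitive x (hS x hx).2.1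
  -- the pivot and the class modulo `p`
  let i₀ : (Fin 3 → ℤ) → Fin 3 := fun x =>
    if ¬ (p : ℤ) ∣ x 0 then 0 else if ¬ (p : ℤ) ∣ x 1 then 1 else 2
  have hi₀ : ∀ x ∈ S, ¬ ((p : ℤ) ∣ x (i₀ x)) := by
    intro x hx
    by_cases h0 : (p : ℤ) ∣ x 0
    · by_cases h1 : (p : ℤ) ∣ x 1
      · have h2 : ¬ (p : ℤ) ∣ x 2 := by
          intro h2
          have hall : ∀ i, (p : ℤ) ∣ x i := by
            intro i; fin_cases i
            · exact h0
            · exact h1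
            · exact h2
          exact hpZ.not_unit ((hS x hx).2.1 _ hall)
        simp only [i₀, h0, h1, not_true_eq_false, if_false]
        exact h2
      · simp only [i₀, h0, h1, not_true_eq_false, if_false, not_false_eq_true, if_true]
    · simp only [i₀, h0, not_false_eq_true, if_true]
  let cl : (Fin 3 → ℤ) → Fin 3 × (Fin 3 → ZMod p) := fun x =>
    (i₀ x, fun l => ((x (i₀ x) : ZMod p))⁻¹ * (x l : ZMod p))
  let f : (Fin 3 → ℤ) → (ℕ → ℕ) × (Fin 3 × (Fin 3 → ZMod p)) := fun x => (glab x, cl x)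
  -- integer arithmetic behind "a class is coplanar"
  have hΔpos : 0 < M.det.natAbs := Int.natAbs_pos.mpr hdet
  have hcoplanar : ∀ X : Matrix (Fin 3) (Fin 3) ℤ, (∀ r, X r ∈ S) →
      (∀ r s, (D : ℤ) ∣ X r ⬝ᵥ M *ᵥ X s) → (p : ℤ) ^ 3 ∣ X.det → X.det = 0 := by
    intro X hXS hXD hXp
    by_contra hX0
    have hgram := det_sq_mul_det_eq M hM X fun r => (hS _ (hXS r)).2.2
    obtain ⟨b01, hb01⟩ := hXD 0 1
    obtain ⟨b02, hb02⟩ := hXD 0 2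
    obtain ⟨b12, hb12⟩ := hXD 1 2
    rw [hb01, hb02, hb12] at hgram
    have hgram' : X.det ^ 2 * M.det = 2 * (D : ℤ) ^ 3 * (b01 * b02 * b12) := by rw [hgram]; ring
    -- `p⁶ ∣ b01 b02 b12`
    have h6 : (p : ℤ) ^ 6 ∣ 2 * (D : ℤ) ^ 3 * (b01 * b02 * b12) := by
      rw [← hgram', show (6 : ℕ) = 3 * 2 from rfl, pow_mul]
      exact (pow_dvd_pow_of_dvd hXp 2).mul_right _
    have hpD : ¬ (p : ℤ) ∣ (D : ℤ) := by
      intro hpD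
      have h1 : p ∣ D := by exact_mod_cast hpD
      exact hpdet (Int.natCast_dvd.mpr (hDprime p hp h1))
    have hcopD : IsCoprime ((p : ℤ) ^ 6) (2 * (D : ℤ) ^ 3) :=
      (((Prime.coprime_iff_not_dvd hpZ).2 hp2Z).mul_right
        ((Prime.coprime_iff_not_dvd hpZ).2 hpD).pow_right).pow_left
    have h6' : (p : ℤ) ^ 6 ∣ b01 * b02 * b12 := hcopD.dvd_of_dvd_mul_left h6
    have hb0 : b01 * b02 * b12 ≠ 0 := by
      intro h0
      have : X.det ^ 2 * M.det = 0 := by rw [hgram', h0]; ring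
      rcases mul_eq_zero.mp this with h | h
      · exact hX0 (pow_eq_zero_iff two_ne_zero |>.mp h)
      · exact hdet h
    -- pass to natural numbers
    obtain ⟨dX, hdX⟩ : ∃ dX : ℕ, dX = X.det.natAbs := ⟨_, rfl⟩
    obtain ⟨bb, hbb⟩ : ∃ bb : ℕ, bb = (b01 * b02 * b12).natAbs := ⟨_, rfl⟩
    obtain ⟨Δ, hΔ⟩ : ∃ Δ : ℕ, Δ = M.det.natAbs := ⟨_, rfl⟩
    obtain ⟨Δ₀, hΔ₀⟩ : ∃ Δ₀ : ℕ, Δ₀ = (minorGcd M).natAbs := ⟨_, rfl⟩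
    obtain ⟨V, hV⟩ : ∃ V : ℕ, V = B 0 * B 1 * B 2 := ⟨_, rfl⟩
    have e1 : dX ^ 2 * Δ = 2 * D ^ 3 * bb := by
      have := congrArg Int.natAbs hgram'
      rw [Int.natAbs_mul, Int.natAbs_pow, Int.natAbs_mul, Int.natAbs_mul, Int.natAbs_pow] at this
      simpa [← hdX, ← hbb, ← hΔ] using this
    have e2 : p ^ 6 ≤ bb := by
      refine Nat.le_of_dvd (by rw [hbb]; exact Int.natAbs_pos.mpr hb0) ?_
      rw [hbb, ← Int.natCast_dvd]; push_cast; exact h6'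
    have hΔ3 : Δ ^ 3 ≤ 8 * D ^ 3 * Δ₀ ^ 4 := by
      have hΔ₀pos : 0 < (minorGcd M).natAbs := Int.natAbs_pos.mpr (minorGcd_ne_zero M hdet)
      rw [hΔ, hΔ₀]
      exact Nat.le_of_dvd (Nat.mul_pos (Nat.mul_pos (by norm_num) (pow_pos hD 3)) (pow_pos hΔ₀pos 4))
        hDineq
    have e3 : (Δ * p ^ 3) ^ 2 * Δ ≤ (2 * Δ₀ ^ 2 * dX) ^ 2 * Δ :=
      calc (Δ * p ^ 3) ^ 2 * Δ = Δ ^ 3 * p ^ 6 := by ring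
        _ ≤ (8 * D ^ 3 * Δ₀ ^ 4) * p ^ 6 := Nat.mul_le_mul_right _ hΔ3
        _ ≤ (8 * D ^ 3 * Δ₀ ^ 4) * bb := Nat.mul_le_mul_left _ e2
        _ = 4 * Δ₀ ^ 4 * (2 * D ^ 3 * bb) := by ring
        _ = 4 * Δ₀ ^ 4 * (dX ^ 2 * Δ) := by rw [e1]
        _ = (2 * Δ₀ ^ 2 * dX) ^ 2 * Δ := by ring
    have hΔpos' : 0 < Δ := by rw [hΔ]; exact hΔpos
    have e4 : (Δ * p ^ 3) ^ 2 ≤ (2 * Δ₀ ^ 2 * dX) ^ 2 := Nat.le_of_mul_le_mul_right e3 hΔpos'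
    have e5 : Δ * p ^ 3 ≤ 2 * Δ₀ ^ 2 * dX := (Nat.pow_le_pow_iff_left two_ne_zero).mp e4
    have e6 : dX ≤ 6 * V := by
      have h1 : |X.det| ≤ 6 * ((B 0 : ℤ) * B 1 * B 2) :=
        SquarefulDet.abs_det_le_of_rows_le X (fun i => (B i : ℤ)) fun r k => (hS _ (hXS r)).1 k
      have h2 : ((dX : ℕ) : ℤ) ≤ ((6 * V : ℕ) : ℤ) := by
        rw [hdX, Int.natCast_natAbs, hV]; push_cast; exact h1
      exact_mod_cast h2
    have hbig' : 12 * V * Δ₀ ^ 2 < p ^ 3 * Δ := by rw [hV, hΔ₀, hΔ]; exact hbig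
    have : Δ * p ^ 3 < Δ * p ^ 3 :=
      calc Δ * p ^ 3 ≤ 2 * Δ₀ ^ 2 * dX := e5
        _ ≤ 2 * Δ₀ ^ 2 * (6 * V) := Nat.mul_le_mul_left _ e6
        _ = 12 * V * Δ₀ ^ 2 := by ring
        _ < p ^ 3 * Δ := hbig'
        _ = Δ * p ^ 3 := by ring
    exact lt_irrefl _ this
  -- Step 1: the fibres of `f` have at most four elements
  have hxunit : ∀ x ∈ S, ((x (i₀ x) : ℤ) : ZMod p) ≠ 0 := fun x hx => by
    rw [Ne, ZMod.intCast_zmod_eq_zero_iff_dvd]; exact hi₀ x hx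
  haveI : Fact (1 < p) := ⟨hp.one_lt⟩
  have hfib : ∀ q ∈ S.image f, #(S.filter fun x => f x = q) ≤ 4 := by
    intro q _
    have hTS : ∀ x ∈ S.filter (fun x => f x = q), x ∈ S := fun x hx => (Finset.mem_filter.mp hx).1
    have hTf : ∀ x ∈ S.filter (fun x => f x = q), f x = q := fun x hx => (Finset.mem_filter.mp hx).2
    refine card_le_four_of_coplanar M hM hdet _ (fun x hx => hprim x (hTS x hx))
      (fun x hx => (hS x (hTS x hx)).2.2) ?_
    intro x hx y hy z hz
    let U : Fin 3 → Fin 3 → ℤ := ![x, y, z]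
    have hXr : ∀ r, U r ∈ S.filter (fun x => f x = q) := by
      intro r; fin_cases r
      · exact hx
      · exact hy
      · exact hz
    have hfr : ∀ r, f (U r) = f (U 0) := fun r => (hTf _ (hXr r)).trans (hTf _ (hXr 0)).symm
    change (Matrix.of U).det = 0
    refine hcoplanar (Matrix.of U) (fun r => hTS _ (hXr r)) (fun r s => ?_) ?_
    · exact hGpol (U r) (U s) (hS _ (hTS _ (hXr r))).2.2 (hS _ (hTS _ (hXr s))).2.2
        ((congrArg Prod.fst (hfr r)).trans (congrArg Prod.fst (hfr s)).symm)
    · have hcl : ∀ r, cl (U r) = cl (U 0) := fun r => congrArg Prod.snd (hfr r)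
      have hi : ∀ r, i₀ (U r) = i₀ (U 0) := fun r => congrArg Prod.fst (hcl r)
      obtain ⟨i, hidef⟩ : ∃ i : Fin 3, i₀ (U 0) = i := ⟨_, rfl⟩
      have hXi : ∀ r, ¬ (p : ℤ) ∣ U r i := fun r => by
        rw [← hidef, ← hi r]; exact hi₀ _ (hTS _ (hXr r))
      have hXi' : ∀ r, ((U r i : ℤ) : ZMod p) ≠ 0 := fun r => by
        rw [Ne, ZMod.intCast_zmod_eq_zero_iff_dvd]; exact hXi r
      obtain ⟨c, hc⟩ : ∃ c : Fin 3 → ZMod p, (fun l => (((U 0 i : ℤ) : ZMod p))⁻¹ * ((U 0 l : ℤ) : ZMod p)) = c :=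
        ⟨_, rfl⟩
      have hcr : ∀ r l, (((U r i : ℤ) : ZMod p))⁻¹ * ((U r l : ℤ) : ZMod p) = c l := by
        intro r l
        have h1 := congrFun (congrArg Prod.snd (hcl r)) l
        simp only [cl] at h1
        rw [hi r, hidef] at h1
        rw [← hc]
        exact h1
      let w : Fin 3 → ℤ := fun l => ((c l).val : ℤ)
      have hwcast : ∀ l, ((w l : ℤ) : ZMod p) = c l := by
        intro l; simp [w]
      have hwi : w i = 1 := by
        have : c i = 1 := by rw [← hcr 0 i]; exact inv_mul_cancel₀ (hXi' 0)
        simp only [w, this, ZMod.val_one, Nat.cast_one]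
      have hcong : ∀ r l, (p : ℤ) ∣ U r l - U r i * w l := by
        intro r l
        rw [← ZMod.intCast_zmod_eq_zero_iff_dvd, Int.cast_sub, Int.cast_mul, hwcast l, ← hcr r l,
          ← mul_assoc, mul_inv_cancel₀ (hXi' r), one_mul, sub_self]
      exact pow_three_dvd_det_of_cls M hM hpZ hp2Z hpdet w i hwi (Matrix.of U) hcong hXi
        fun r => (hS _ (hTS _ (hXr r))).2.2
  -- Step 2: the image of `f`
  obtain ⟨A, hA⟩ : ∃ A : Matrix (Fin 3) (Fin 3) (ZMod p), A = M.map (Int.castRingHom (ZMod p)) :=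
    ⟨_, rfl⟩
  have hAsymm : A.IsSymm := by rw [hA]; exact hM.map _
  have hAdet : A.det ≠ 0 := by
    rw [hA, ← RingHom.mapMatrix_apply, ← RingHom.map_det, eq_intCast, Ne,
      ZMod.intCast_zmod_eq_zero_iff_dvd]
    exact hpdet
  set ClsSet := Finset.univ.filter fun q : Fin 3 × (Fin 3 → ZMod p) =>
    q.2 q.1 = 1 ∧ q.2 ⬝ᵥ A *ᵥ q.2 = 0 with hClsSet
  have hcastq : ∀ x : Fin 3 → ℤ, ((x ⬝ᵥ M *ᵥ x : ℤ) : ZMod p) =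
      (fun l => ((x l : ℤ) : ZMod p)) ⬝ᵥ A *ᵥ (fun l => ((x l : ℤ) : ZMod p)) := by
    intro x
    have h1 := RingHom.map_dotProduct (Int.castRingHom (ZMod p)) x (M *ᵥ x)
    have h2 : (Int.castRingHom (ZMod p)) ∘ (M *ᵥ x) =
        M.map (Int.castRingHom (ZMod p)) *ᵥ ((Int.castRingHom (ZMod p)) ∘ x) :=
      funext fun i => RingHom.map_mulVec _ _ _ _
    rw [h2, ← hA] at h1
    rw [eq_intCast] at h1
    rw [h1]
    rfl
  have himg : S.image f ⊆ G ×ˢ ClsSet := by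
    intro q hq
    obtain ⟨x, hx, rfl⟩ := Finset.mem_image.mp hq
    simp only [Finset.mem_product]
    refine ⟨hGmem x (hS x hx).2.2, ?_⟩
    rw [hClsSet, Finset.mem_filter]
    refine ⟨Finset.mem_univ _, inv_mul_cancel₀ (hxunit x hx), ?_⟩
    have hz : (fun l => ((x l : ℤ) : ZMod p)) ⬝ᵥ A *ᵥ (fun l => ((x l : ℤ) : ZMod p)) = 0 := by
      rw [← hcastq x, (hS x hx).2.2, Int.cast_zero]
    have hsm : (fun l => (((x (i₀ x) : ℤ) : ZMod p))⁻¹ * ((x l : ℤ) : ZMod p)) =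
        (((x (i₀ x) : ℤ) : ZMod p))⁻¹ • (fun l => ((x l : ℤ) : ZMod p)) := by
      funext l; simp
    show (fun l => (((x (i₀ x) : ℤ) : ZMod p))⁻¹ * ((x l : ℤ) : ZMod p)) ⬝ᵥ
      A *ᵥ (fun l => (((x (i₀ x) : ℤ) : ZMod p))⁻¹ * ((x l : ℤ) : ZMod p)) = 0
    rw [hsm, Matrix.mulVec_smul, dotProduct_smul, smul_dotProduct, hz, smul_zero, smul_zero]
  -- Step 3: counting
  have hCls : #ClsSet ≤ 3 * (3 * p) := by rw [hClsSet]; exact card_clsSet_le hp2 A hAsymm hAdet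
  calc #S ≤ 4 * #(S.image f) := Finset.card_le_mul_card_image S 4 hfib
    _ ≤ 4 * #(G ×ˢ ClsSet) := by gcongr
    _ = 4 * (#G * #ClsSet) := by rw [Finset.card_product]
    _ ≤ 4 * (#M.det.natAbs.divisors ^ 3 * (3 * (3 * p))) := by gcongr

end TernaryConic

/-- `12^{1/3} ≤ 3`. [folklore] -/
theorem TernaryConic.rpow_twelve_third_le : (12 : ℝ) ^ (1 / 3 : ℝ) ≤ 3 := by
  calc (12 : ℝ) ^ (1 / 3 : ℝ) ≤ (27 : ℝ) ^ (1 / 3 : ℝ) :=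
        Real.rpow_le_rpow (by norm_num) (by norm_num) (by norm_num)
    _ = 3 := by
        rw [show (27 : ℝ) = (3 : ℝ) ^ (3 : ℕ) by norm_num, ← Real.rpow_natCast,
          ← Real.rpow_mul (by norm_num)]
        norm_num

open Finset Matrix in
/-- **Heath-Brown's bound for primitive zeros of a ternary quadratic form in a box**
([Heathbrown2002, Cor. 2], in the `δ`-absorbed form of `TernaryConicPointBound`): for `δ > 0` there
is `C` with `#{x primitive, |xᵢ| ≤ Bᵢ, xᵀMx = 0} ≤ C (B₀B₁B₂·|det M|)^δ (1 + (B₀B₁B₂Δ₀²/|det M|)^{1/3})`.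
Proof (following [Heathbrown1997, §2, proof of Thm 2] with the exponent `1/3` of [Heathbrown2002]):
global classes (`TernaryConic.global_labels`, `≤ τ(Δ)³ ≪ Δ^{δ/2}` of them), an auxiliary prime
`p ∤ 2Δ` with `p³Δ > 12VΔ₀²` and `p ≪ (1 + (VΔ₀²/Δ)^{1/3}) Δ^{δ/2}`
(`TernaryConic.exists_prime_not_dvd_le_rpow`), and the count `TernaryConic.card_le_of_prime`.
[cite: Heathbrown2002, Cor. 2] -/
theorem TernaryConicPointBound_holds : TernaryConicPointBound := by
  classical
  intro δ hδ
  obtain ⟨C₁, hC₁, hτ⟩ :=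
    Literature.NumberTheory.Sieve.exists_card_divisors_le_mul_rpow (ε := δ / 6) (by positivity)
  obtain ⟨C₂, hC₂, hprime⟩ := TernaryConic.exists_prime_not_dvd_le_rpow (δ := δ / 2) (by positivity)
  refine ⟨108 * C₁ ^ 3 * C₂ * (2 : ℝ) ^ (δ / 2), fun M hM hdet B hB => ?_⟩
  -- natural-number data
  obtain ⟨Δ, hΔ⟩ : ∃ Δ : ℕ, Δ = M.det.natAbs := ⟨_, rfl⟩
  have hΔ0 : Δ ≠ 0 := by rw [hΔ]; exact Int.natAbs_ne_zero.mpr hdet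
  obtain ⟨Δ₀, hΔ₀⟩ : ∃ Δ₀ : ℕ, Δ₀ = (minorGcd M).natAbs := ⟨_, rfl⟩
  obtain ⟨V, hV⟩ : ∃ V : ℕ, V = B 0 * B 1 * B 2 := ⟨_, rfl⟩
  have hV1 : 1 ≤ V := by
    rw [hV]; exact Nat.mul_pos (Nat.mul_pos (hB 0) (hB 1)) (hB 2)
  -- the threshold `P₀`: least `n` with `12 V Δ₀² < n³ Δ`
  have hex : ∃ n : ℕ, 12 * V * Δ₀ ^ 2 < n ^ 3 * Δ := by
    refine ⟨12 * V * Δ₀ ^ 2 + 1, ?_⟩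
    have h1 : 1 ≤ Δ := Nat.pos_of_ne_zero hΔ0
    calc 12 * V * Δ₀ ^ 2 < (12 * V * Δ₀ ^ 2 + 1) * 1 := by omega
      _ ≤ (12 * V * Δ₀ ^ 2 + 1) ^ 3 * Δ := by
          refine Nat.mul_le_mul ?_ h1
          calc (12 * V * Δ₀ ^ 2 + 1) = (12 * V * Δ₀ ^ 2 + 1) ^ 1 := (pow_one _).symm
            _ ≤ (12 * V * Δ₀ ^ 2 + 1) ^ 3 := Nat.pow_le_pow_right (by omega) (by norm_num)
  obtain ⟨P₀, hP₀def⟩ : ∃ P₀ : ℕ, P₀ = Nat.find hex := ⟨_, rfl⟩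
  have hP₀ : 12 * V * Δ₀ ^ 2 < P₀ ^ 3 * Δ := by rw [hP₀def]; exact Nat.find_spec hex
  have hP₀1 : 1 ≤ P₀ := by
    rcases Nat.eq_zero_or_pos P₀ with h | h
    · rw [h] at hP₀; simp at hP₀
    · exact h
  have hP₀min : (P₀ - 1) ^ 3 * Δ ≤ 12 * V * Δ₀ ^ 2 := by
    have := Nat.find_min hex (show P₀ - 1 < Nat.find hex by rw [← hP₀def]; omega)
    exact not_lt.mp this
  -- the auxiliary prime
  obtain ⟨p, hp, hpP, hpm, hple⟩ := hprime P₀ (2 * Δ) hP₀1 (by omega)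
  have hp2 : p ≠ 2 := fun h => hpm (h ▸ dvd_mul_right 2 Δ)
  have hpΔ : ¬ p ∣ Δ := fun h => hpm (dvd_mul_of_dvd_right h 2)
  have hpdet : ¬ (p : ℤ) ∣ M.det := fun h => hpΔ (by rw [hΔ]; exact Int.natCast_dvd.mp h)
  have hbig : 12 * (B 0 * B 1 * B 2) * (minorGcd M).natAbs ^ 2 < p ^ 3 * M.det.natAbs := by
    rw [← hV, ← hΔ₀, ← hΔ]
    calc 12 * V * Δ₀ ^ 2 < P₀ ^ 3 * Δ := hP₀
      _ ≤ p ^ 3 * Δ := Nat.mul_le_mul_right _ (Nat.pow_le_pow_left hpP 3)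
  have hcount := TernaryConic.card_le_of_prime M hM hdet B hp hp2 hpdet hbig
  rw [← hΔ] at hcount
  -- real estimates
  have hΔR : (0 : ℝ) < Δ := by exact_mod_cast Nat.pos_of_ne_zero hΔ0
  have hVR : (1 : ℝ) ≤ V := by exact_mod_cast hV1
  have hτR : (#Δ.divisors : ℝ) ≤ C₁ * (Δ : ℝ) ^ (δ / 6) := hτ Δ hΔ0
  have hpR : (p : ℝ) ≤ C₂ * P₀ * ((2 * Δ : ℕ) : ℝ) ^ (δ / 2) := hple
  have hR0 : (0 : ℝ) ≤ (V : ℝ) * (Δ₀ : ℝ) ^ 2 / Δ := by positivity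
  have hP₀R : (P₀ : ℝ) ≤ 3 * (1 + ((V : ℝ) * (Δ₀ : ℝ) ^ 2 / Δ) ^ (1 / 3 : ℝ)) := by
    have h1 : ((P₀ : ℝ) - 1) ^ 3 ≤ 12 * ((V : ℝ) * (Δ₀ : ℝ) ^ 2 / Δ) := by
      have h2 : (((P₀ - 1 : ℕ) : ℝ)) ^ 3 * Δ ≤ 12 * V * (Δ₀ : ℝ) ^ 2 := by exact_mod_cast hP₀min
      rw [Nat.cast_sub hP₀1, Nat.cast_one] at h2
      rw [mul_div_assoc', le_div_iff₀ hΔR]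
      calc ((P₀ : ℝ) - 1) ^ 3 * Δ ≤ 12 * V * (Δ₀ : ℝ) ^ 2 := h2
        _ = 12 * ((V : ℝ) * (Δ₀ : ℝ) ^ 2) := by ring
    have h3 : (P₀ : ℝ) - 1 ≤ (12 * ((V : ℝ) * (Δ₀ : ℝ) ^ 2 / Δ)) ^ (1 / 3 : ℝ) := by
      have h4 : (0 : ℝ) ≤ (P₀ : ℝ) - 1 := by
        have : (1 : ℝ) ≤ P₀ := by exact_mod_cast hP₀1
        linarith
      calc (P₀ : ℝ) - 1 = (((P₀ : ℝ) - 1) ^ 3) ^ (((3 : ℕ) : ℝ)⁻¹) :=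
            (Real.pow_rpow_inv_natCast h4 three_ne_zero).symm
        _ = (((P₀ : ℝ) - 1) ^ 3) ^ (1 / 3 : ℝ) := by norm_num
        _ ≤ (12 * ((V : ℝ) * (Δ₀ : ℝ) ^ 2 / Δ)) ^ (1 / 3 : ℝ) :=
            Real.rpow_le_rpow (by positivity) h1 (by norm_num)
    rw [Real.mul_rpow (by norm_num) hR0] at h3
    have h5 := TernaryConic.rpow_twelve_third_le
    have h6 : (0 : ℝ) ≤ ((V : ℝ) * (Δ₀ : ℝ) ^ 2 / Δ) ^ (1 / 3 : ℝ) := by positivity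
    nlinarith
  -- assembling
  have hcountR : ((primitiveConicZeros M B).ncard : ℝ) ≤ 4 * ((#Δ.divisors : ℝ) ^ 3 * (3 * (3 * p))) := by
    exact_mod_cast hcount
  have hτ3 : (#Δ.divisors : ℝ) ^ 3 ≤ C₁ ^ 3 * (Δ : ℝ) ^ (δ / 2) := by
    calc (#Δ.divisors : ℝ) ^ 3 ≤ (C₁ * (Δ : ℝ) ^ (δ / 6)) ^ 3 := by gcongr
      _ = C₁ ^ 3 * ((Δ : ℝ) ^ (δ / 6)) ^ 3 := by ring
      _ = C₁ ^ 3 * (Δ : ℝ) ^ (δ / 2) := by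
          have : ((Δ : ℝ) ^ (δ / 6)) ^ (3 : ℕ) = (Δ : ℝ) ^ (δ / 2) := by
            rw [← Real.rpow_natCast, ← Real.rpow_mul hΔR.le]
            congr 1
            push_cast
            ring
          rw [this]
  have h2Δ : ((2 * Δ : ℕ) : ℝ) ^ (δ / 2) = (2 : ℝ) ^ (δ / 2) * (Δ : ℝ) ^ (δ / 2) := by
    push_cast
    exact Real.mul_rpow (by norm_num) hΔR.le
  have hΔδ : (Δ : ℝ) ^ (δ / 2) * (Δ : ℝ) ^ (δ / 2) = (Δ : ℝ) ^ δ := by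
    rw [← Real.rpow_add hΔR]; ring_nf
  have hΔVδ : (Δ : ℝ) ^ δ ≤ ((V : ℝ) * Δ) ^ δ :=
    Real.rpow_le_rpow hΔR.le (le_mul_of_one_le_left hΔR.le hVR) hδ.le
  -- identify the real quantities in the statement
  have eV : ((B 0 : ℝ) * B 1 * B 2) = (V : ℝ) := by rw [hV]; push_cast; ring
  have eΔ : |(M.det : ℝ)| = (Δ : ℝ) := by rw [hΔ, Nat.cast_natAbs, Int.cast_abs]
  have eΔ₀ : ((minorGcd M : ℝ)) ^ 2 = (Δ₀ : ℝ) ^ 2 := by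
    rw [hΔ₀, Nat.cast_natAbs, Int.cast_abs, sq_abs]
  rw [eV, eΔ, eΔ₀]
  set R : ℝ := ((V : ℝ) * (Δ₀ : ℝ) ^ 2 / Δ) ^ (1 / 3 : ℝ) with hRdef
  have hRnn : 0 ≤ R := by rw [hRdef]; positivity
  calc ((primitiveConicZeros M B).ncard : ℝ)
      ≤ 4 * ((#Δ.divisors : ℝ) ^ 3 * (3 * (3 * p))) := hcountR
    _ = 36 * (#Δ.divisors : ℝ) ^ 3 * p := by ring
    _ ≤ 36 * (C₁ ^ 3 * (Δ : ℝ) ^ (δ / 2)) * (C₂ * P₀ * ((2 * Δ : ℕ) : ℝ) ^ (δ / 2)) := by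
        gcongr
    _ = 36 * C₁ ^ 3 * C₂ * (2 : ℝ) ^ (δ / 2) * ((Δ : ℝ) ^ (δ / 2) * (Δ : ℝ) ^ (δ / 2)) * P₀ := by
        rw [h2Δ]; ring
    _ = 36 * C₁ ^ 3 * C₂ * (2 : ℝ) ^ (δ / 2) * (Δ : ℝ) ^ δ * P₀ := by rw [hΔδ]
    _ ≤ 36 * C₁ ^ 3 * C₂ * (2 : ℝ) ^ (δ / 2) * ((V : ℝ) * Δ) ^ δ * (3 * (1 + R)) := by
        gcongr
    _ = 108 * C₁ ^ 3 * C₂ * (2 : ℝ) ^ (δ / 2) * ((V : ℝ) * Δ) ^ δ * (1 + R) := by ring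

end Literature.NumberTheory.DiophantineGeometry
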